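import Summits.HodgeConjecture.HodgeConjecture.Theses.NikulinTwinTransport

/-!
# `TwinTwistorTransport` (stmt-HodgeConjecture-14522) · Negative · genericity of the first line

Negative knowledge for clauses (a)–(b) of the informal crux `TwinTwistorTransport` (route
NikulinTwinTransport, r4), in the twin form of the negatives-index entry
`ELineTransport.ELineConnectivity` (refuted 2026-08-15: a PRESCRIBED first 3-space orthogonal to a
rational vector admits no generic first link).

* `perp_of_oneOne_along_line`, `eq_zero_of_oneOne_along_generic_line` — on either factor of the
  Ψ-matched product, a class that is of type `(1,1)` for EVERY complex structure of a twistor line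
  (`W` the positive 3-space of the hyperkähler triple; the structure with Kähler direction `u ∈ W ∖ 0`
  has period plane `u^⊥ ∩ W`) is orthogonal to all of `W`; on a GENERIC line (`W^⊥ ∩ Λ = 0`,
  Huybrechts, K3 book, Ch. 7 Def. 3.1; Markman 2024 Def. 5.13) such a LATTICE class is `0`.  So an
  UNTWISTED sheaf carried along a generic diagonal line has `c₁ = 0` on both factors (Verbitsky: the
  Chern classes of a hyperholomorphic sheaf are `SU(2)`-invariant ⟺ `(p,p)` for all induced
  structures), and the Serre carrier (`c₁ = pr₂^*δ`) must be modified or transported twisted.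
* `exists_integral_perp_of_rational_ray` — a RATIONAL Kähler direction on a factor of Picard rank
  `≥ 2` (the Nikulin anchor has `ρ = 9` on both sides) is orthogonal to a nonzero INTEGRAL class;
  that class then lies in the Néron–Severi group `x^⊥ ∩ Λ` of every period `x` of the line
  (`Re x, Im x ∈ W`), so the first line of a chain started on a rational matched ray `H ⊞ tH′` has NO
  Pic-trivial node and the class-switching step of (b) (Pic `= 0 ⇒ 𝒦 = 𝒞⁺`, stability
  class-independent: Buskin 2019 p. 21; Markman 2024 Lemmas 5.14–5.15) is unavailable on it.  Hence
  Markman's hypothesis Prop. 5.19 (i) — stability for every class of a non-empty OPEN subcone of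
  matched classes — is load-bearing: the typed clause (b) must assert the EXISTENCE of a generic
  first line inside the stability cone, never prescribe it.

Refuter seat refuter-cdisprove-stmt-HodgeConjecture-14522-g2-0 (gen 2), 2026-08-15.
-/

namespace Summit.HodgeConjecture.HodgeConjecture.Theorems.TwinTwistorTransport.Negative

section RealPeriods

variable {V : Type*} [AddCommGroup V] [Module ℝ V]

/-- A class of type `(1,1)` along a whole twistor line is orthogonal to the 3-space `W` of the line,
as soon as the form is positive definite on `W` and `W` is not a line: every `w ∈ W` lies in the
period plane of the structure `u = x − (B x w / B w w)·w`, `x ∈ W ∖ ℝw`. [folklore] -/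
theorem perp_of_oneOne_along_line (B : V →ₗ[ℝ] V →ₗ[ℝ] ℝ) (W : Submodule ℝ V)
    (hpos : ∀ w ∈ W, w ≠ 0 → 0 < B w w) (hW2 : ∀ w : V, ∃ x ∈ W, ∀ a : ℝ, x ≠ a • w) {v : V}
    (hv : ∀ u ∈ W, u ≠ 0 → ∀ p ∈ W, B u p = 0 → B v p = 0) : ∀ w ∈ W, B v w = 0 := by
  intro w hw
  by_cases hw0 : w = 0
  · simp [hw0]
  obtain ⟨x, hx, hxa⟩ := hW2 w
  have hww : B w w ≠ 0 := (hpos w hw hw0).ne'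
  set u : V := x - (B x w / B w w) • w with hu
  have huW : u ∈ W := W.sub_mem hx (W.smul_mem _ hw)
  have hu0 : u ≠ 0 := by
    intro h
    apply hxa (B x w / B w w)
    rwa [hu, sub_eq_zero] at h
  have huw : B u w = 0 := by
    simp only [hu, map_sub, map_smul, LinearMap.sub_apply, LinearMap.smul_apply, smul_eq_mul]
    field_simp
    ring
  exact hv u huW hu0 w hw huw

/-- GENERIC-LINE RIGIDITY: on a generic line (`W^⊥ ∩ Λ = 0`) the only lattice class of type `(1,1)`
along the whole line is `0`; untwisted transport along a generic diagonal line forces `c₁ = 0` on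
both factors. [folklore] -/
theorem eq_zero_of_oneOne_along_generic_line (B : V →ₗ[ℝ] V →ₗ[ℝ] ℝ) (W : Submodule ℝ V)
    (hpos : ∀ w ∈ W, w ≠ 0 → 0 < B w w) (hW2 : ∀ w : V, ∃ x ∈ W, ∀ a : ℝ, x ≠ a • w)
    (Λ : AddSubgroup V) (hgen : ∀ v ∈ Λ, (∀ w ∈ W, B v w = 0) → v = 0) {v : V} (hvΛ : v ∈ Λ)
    (hv : ∀ u ∈ W, u ≠ 0 → ∀ p ∈ W, B u p = 0 → B v p = 0) : v = 0 :=
  hgen v hvΛ (perp_of_oneOne_along_line B W hpos hW2 hv)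

end RealPeriods

section RationalRays

variable {V : Type*} [AddCommGroup V] [Module ℚ V]

/-- RATIONAL RAYS ARE NEVER GENERIC: for any bilinear form `B` on `NS ⊗ ℚ`, two linearly independent
lattice classes `e₁, e₂` and any rational direction `ω`, some nonzero element of `⟨e₁, e₂⟩_ℤ` is
`B`-orthogonal to `ω` (witness `q₂e₁ − q₁e₂`, `qᵢ = B ω eᵢ`, denominators cleared; `e₁` if
`q₁ = q₂ = 0`).  On the twin product this is the first-link obstruction of the refuted
`ELineTransport.ELineConnectivity`: such a class is in `NS` of every point of the line through `ω`.
[folklore] -/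
theorem exists_integral_perp_of_rational_ray (B : V →ₗ[ℚ] V →ₗ[ℚ] ℚ) {e₁ e₂ : V}
    (hli : LinearIndependent ℚ ![e₁, e₂]) (ω : V) :
    ∃ v ∈ Submodule.span ℤ ({e₁, e₂} : Set V), v ≠ 0 ∧ B ω v = 0 := by
  have he₁ : e₁ ∈ Submodule.span ℤ ({e₁, e₂} : Set V) := Submodule.subset_span (by simp)
  have he₂ : e₂ ∈ Submodule.span ℤ ({e₁, e₂} : Set V) := Submodule.subset_span (by simp)
  have hpair := LinearIndependent.pair_iff.1 hli
  by_cases h : B ω e₁ = 0 ∧ B ω e₂ = 0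
  · refine ⟨e₁, he₁, ?_, h.1⟩
    intro h0
    have := hpair 1 0 (by simp [h0])
    simp at this
  · set q₁ := B ω e₁ with hq₁
    set q₂ := B ω e₂ with hq₂
    refine ⟨(q₂.num * q₁.den : ℤ) • e₁ - (q₁.num * q₂.den : ℤ) • e₂,
      sub_mem (Submodule.smul_mem _ _ he₁) (Submodule.smul_mem _ _ he₂), ?_, ?_⟩
    · intro h0
      have h0' : ((q₂.num * q₁.den : ℤ) : ℚ) • e₁ + (-((q₁.num * q₂.den : ℤ) : ℚ)) • e₂ = 0 := by
        rw [neg_smul, ← sub_eq_add_neg, Int.cast_smul_eq_zsmul, Int.cast_smul_eq_zsmul]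
        exact h0
      obtain ⟨h₁, h₂⟩ := hpair _ _ h0'
      have hd₁ : (q₁.den : ℚ) ≠ 0 := by exact_mod_cast q₁.den_nz
      have hd₂ : (q₂.den : ℚ) ≠ 0 := by exact_mod_cast q₂.den_nz
      have hn₂ : (q₂.num : ℚ) = 0 := by
        have : (q₂.num : ℚ) * q₁.den = 0 := by exact_mod_cast h₁
        exact (mul_eq_zero.1 this).resolve_right hd₁
      have hn₁ : (q₁.num : ℚ) = 0 := by
        have : (q₁.num : ℚ) * q₂.den = 0 := by
          have := neg_eq_zero.1 h₂; exact_mod_cast this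
        exact (mul_eq_zero.1 this).resolve_right hd₂
      apply h
      constructor
      · have := Rat.mul_den_eq_num q₁; rw [hn₁] at this
        exact (mul_eq_zero.1 this).resolve_right hd₁
      · have := Rat.mul_den_eq_num q₂; rw [hn₂] at this
        exact (mul_eq_zero.1 this).resolve_right hd₂
    · have e1 : (q₁.num : ℚ) = q₁ * q₁.den := (Rat.mul_den_eq_num q₁).symm
      have e2 : (q₂.num : ℚ) = q₂ * q₂.den := (Rat.mul_den_eq_num q₂).symm
      simp only [map_sub, map_zsmul, zsmul_eq_mul, Int.cast_mul, Int.cast_natCast]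
      rw [← hq₁, ← hq₂, e1, e2]
      ring

end RationalRays

end Summit.HodgeConjecture.HodgeConjecture.Theorems.TwinTwistorTransport.Negative
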